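import Literature.NumberTheory.PAdicHodge.BdRPlusGaloisContinuity
import Literature.NumberTheory.PAdicHodge.BdRPlusTopology
import HarnessLib

/-!
# Fontaine's lattices of `B_dR⁺` are separated: `⋂_N (p^N ι(𝔸_inf) + ξ^k B_dR⁺) = ξ^k B_dR⁺` and `𝔸_inf ∩ ξ^k B_dR⁺ = ξ^k 𝔸_inf`

Topic `Literature/NumberTheory/PAdicHodge`; THEOREMS ONLY (no definition, no named fact, no instance, no `sorry`). Sequel to
`BdRPlusGaloisContinuity`, whose lattices `Λ(N, k) = p^N·ι(𝔸_inf) + ξ^k·B_dR⁺` (membership displayed as `∃ a w, x = ι(p^N a) + ξ^k w`)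
are the unit balls of the `ℚ_p`-Banach spaces `B_dR⁺/Fil^k = (𝔸_inf/ξ^k)[1/p]` (Fontaine, Exp. II §1.5.3; Kato LNM 1553 II §1.2.5).
Every "`p`-adic limit inside `B_dR⁺`" argument — `ℤ_p`-linearity and continuity of the period maps `τ ↦ ∫_τ ω, ∫_τ η` of formal groups
(Colmez 1992 §2), Kato's dévissage — ends with: an element lying in `Λ(N, k)` for all `N` (and all `k`) is `0`. This file proves it:

* §1 **`𝔸_inf ∩ ξ^k B_dR⁺ = ξ^k 𝔸_inf`** (`mem_span_xi_pow_of_ainfToBdR_eq`): `ι(a) = ξ^k w ⇒ a ∈ ξ^k𝔸_inf` (`ker θ ∩ 𝔸_inf = ξ𝔸_inf`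
  and `ξ` is a non-zero-divisor of `B_dR⁺`, by induction on `k`);
* §2 **`⋂_N Λ(N, k) = ξ^k B_dR⁺`** (`mem_span_xiBdR_pow_of_forall_lattice`): if `x = ι(p^N a_N) + ξ^k w_N` for every `N` then
  `a₀ − p^N a_N ∈ ξ^k𝔸_inf` (§1), so `a₀ ∈ ξ^k𝔸_inf` because `ξ^k𝔸_inf` is `p`-adically closed (tree `mem_span_xi_pow_of_forall`);
* §3 **`⋂_{N,k} Λ(N, k) = 0`** (`eq_zero_of_forall_lattice`): `B_dR⁺` is `ξ`-adically separated (tree `isAdicComplete_span_xiBdR`);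
  and the same three statements transported to the topological copy `BdRPlusTop F p` (`BdRPlusTop.ofAinf`, `Fil¹ = (ξ_dR)`).

BSD context: crux K★ `stmt-BirchSwinnertonDyer-22226`, hDR sector (iii) road (A), step (E0-lite) towards `ℤ_p`-linearity of
`omegaPeriodHom` / `etaPeriodHom`. BSD is not proved by any of this.

## References
* J.-M. Fontaine, *Le corps des périodes p-adiques*, Astérisque 223 (1994), Exp. II §1.5.3–1.5.5. [FontaineAsterisque223III]
* J.-M. Fontaine, Y. Ouyang, *Theory of p-adic Galois representations*, Prop. 4.4.3, §5.2. [FontaineOuyang2022]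
* K. Kato, LNM 1553 (1993), Ch. II §1.2.5. [Kato1993LNM1553]
-/

noncomputable section

open ValuativeRel Field Ideal WittVector Topology Filter

namespace Literature.NumberTheory.PAdicHodge

open Literature.NumberTheory.GaloisRepresentations
open Literature.NumberTheory.GaloisRepresentations.IsNonarchimedeanLocalField

namespace GaloisContinuity

variable {F : Type} [Field F] [ValuativeRel F] [TopologicalSpace F] [IsNonarchimedeanLocalField F]
  [CharZero F] {p : ℕ} [Fact p.Prime] [Fact (¬ IsUnit (p : integerC F))]
  [IsAdicComplete (Ideal.span {(p : integerC F)}) (integerC F)]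

/-! ## §1 `𝔸_inf ∩ ξ^k B_dR⁺ = ξ^k 𝔸_inf` -/

/-- **`𝔸_inf ∩ ξ^k B_dR⁺ = ξ^k 𝔸_inf`**: if `ι(a) = ξ_dR^k · w` in `B_dR⁺` then `a ∈ ξ^k 𝔸_inf`.
[cite: FontaineAsterisque223III, Exp. II §1.5.3] [cite: FontaineOuyang2022, Prop. 4.4.3] -/
theorem mem_span_xi_pow_of_ainfToBdR_eq {k : ℕ} {a : Ainf (p := p) F} {w : BDeRhamPlus (integerC F) p}
    (h : ainfToBdR a = xiBdR ^ k * w) : a ∈ Ideal.span {(xi : Ainf (p := p) F) ^ k} := by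
  induction k generalizing a with
  | zero => rw [pow_zero, Ideal.span_singleton_one]; exact Submodule.mem_top
  | succ k ih =>
    have h' : xiBdR * 0 = ainfToBdR a + xiBdR ^ (k + 1) * (-w) := by rw [h]; ring
    obtain ⟨a', rfl, h0⟩ := exists_eq_of_xiBdR_mul_eq h'
    have h1 : ainfToBdR a' = xiBdR ^ k * w := by
      have h2 : ainfToBdR a' + xiBdR ^ k * (-w) = 0 := h0.symm
      rw [mul_neg, ← sub_eq_add_neg, sub_eq_zero] at h2
      exact h2
    rw [pow_succ']
    exact Ideal.mul_mem_mul (Ideal.mem_span_singleton_self _) (ih h1) |> fun hm => by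
      rwa [Ideal.span_singleton_mul_span_singleton] at hm

/-- The same with the lattice scaling: `ι(p^N a) = ξ_dR^k w ⇒ p^N a ∈ ξ^k 𝔸_inf`, hence `a ∈ ξ^k𝔸_inf + …` is NOT claimed — only the
displayed product. [cite: FontaineAsterisque223III, Exp. II §1.5.3] -/
theorem sub_mem_span_xi_pow_of_eq {k N : ℕ} {a b : Ainf (p := p) F} {w w' : BDeRhamPlus (integerC F) p}
    (ha : ainfToBdR a + xiBdR ^ k * w = ainfToBdR ((p : Ainf (p := p) F) ^ N * b) + xiBdR ^ k * w') :
    a - (p : Ainf (p := p) F) ^ N * b ∈ Ideal.span {(xi : Ainf (p := p) F) ^ k} := by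
  refine mem_span_xi_pow_of_ainfToBdR_eq (w := w' - w) ?_
  rw [map_sub, mul_sub]
  linear_combination ha

/-! ## §2 `⋂_N Λ(N, k) = ξ^k B_dR⁺` -/

/-- **The lattices are separated modulo `Fil^k`**: if `x ∈ p^N ι(𝔸_inf) + ξ^k B_dR⁺` for every `N`, then `x ∈ ξ^k B_dR⁺`
(`ξ^k 𝔸_inf` is `p`-adically closed in `𝔸_inf`). [cite: FontaineAsterisque223III, Exp. II §1.5.3] [cite: FontaineOuyang2022, Prop. 4.4.3] -/
theorem mem_span_xiBdR_pow_of_forall_lattice {x : BDeRhamPlus (integerC F) p} {k : ℕ}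
    (h : ∀ N : ℕ, ∃ (a : Ainf (p := p) F) (w : BDeRhamPlus (integerC F) p),
      x = ainfToBdR ((p : Ainf (p := p) F) ^ N * a) + xiBdR ^ k * w) :
    x ∈ Ideal.span {(xiBdR : BDeRhamPlus (integerC F) p) ^ k} := by
  obtain ⟨a₀, w₀, h₀⟩ := h 0
  rw [pow_zero, one_mul] at h₀
  have ha₀ : a₀ ∈ Ideal.span {(xi : Ainf (p := p) F) ^ k} := by
    refine mem_span_xi_pow_of_forall k fun N => ?_
    obtain ⟨a, w, hN⟩ := h N
    obtain ⟨c, hc⟩ := Ideal.mem_span_singleton'.1 (sub_mem_span_xi_pow_of_eq (h₀.symm.trans hN))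
    exact ⟨c, a, by rw [mul_comm, hc]; ring⟩
  obtain ⟨c, hc⟩ := Ideal.mem_span_singleton'.1 ha₀
  rw [h₀, ← hc, map_mul, map_pow, ainfToBdR_xi]
  exact Submodule.add_mem _ (Ideal.mul_mem_left _ _ (Ideal.mem_span_singleton_self _))
    (Ideal.mul_mem_right _ _ (Ideal.mem_span_singleton_self _))

/-! ## §3 `⋂_{N,k} Λ(N, k) = 0` -/

/-- **Fontaine's topology on `B_dR⁺` is Hausdorff**: an element lying in every lattice `p^N ι(𝔸_inf) + ξ^k B_dR⁺` is `0`
(`B_dR⁺` is `ξ`-adically separated). [cite: FontaineAsterisque223III, Exp. II §1.5.5] -/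
theorem eq_zero_of_forall_lattice {x : BDeRhamPlus (integerC F) p}
    (h : ∀ k N : ℕ, ∃ (a : Ainf (p := p) F) (w : BDeRhamPlus (integerC F) p),
      x = ainfToBdR ((p : Ainf (p := p) F) ^ N * a) + xiBdR ^ k * w) : x = 0 := by
  haveI := isAdicComplete_span_xiBdR (F := F) (p := p)
  refine IsHausdorff.haus (IsAdicComplete.toIsHausdorff (I := Ideal.span {(xiBdR : BDeRhamPlus (integerC F) p)})) x
    fun k => ?_
  rw [smul_eq_mul, Ideal.mul_top, Ideal.span_singleton_pow, SModEq.zero]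
  exact mem_span_xiBdR_pow_of_forall_lattice (h k)

end GaloisContinuity

/-! ## §4 Transport to `BdRPlusTop` -/

namespace BdRPlusTop

variable {F : Type} [Field F] [ValuativeRel F] [TopologicalSpace F] [IsNonarchimedeanLocalField F]
  [CharZero F] {p : ℕ} [Fact p.Prime] [Fact (¬ IsUnit (p : integerC F))]
  [IsAdicComplete (Ideal.span {(p : integerC F)}) (integerC F)]

/-- `𝔸_inf ∩ Fil^k = ξ^k 𝔸_inf` on `BdRPlusTop`: `ofAinf a ∈ (ξ_dR)^k ⇒ a ∈ ξ^k𝔸_inf`. [cite: FontaineAsterisque223III, Exp. II §1.5.3] -/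
theorem mem_span_xi_pow_of_ofAinf_mem {k : ℕ} {a : Ainf (p := p) F}
    (h : ofAinf F p a ∈ ((filOne F p).toIdeal ^ k : Ideal (BdRPlusTop F p))) : a ∈ Ideal.span {(xi : Ainf (p := p) F) ^ k} := by
  rw [show (filOne F p).toIdeal = (WithIdeal.i : Ideal (BdRPlusTop F p)) from rfl, ideal_eq, Ideal.span_singleton_pow,
    Ideal.mem_span_singleton'] at h
  obtain ⟨w, hw⟩ := h
  exact GaloisContinuity.mem_span_xi_pow_of_ainfToBdR_eq (w := (of F p).symm w) (by
    change ofAinf F p a = of F p xiBdR ^ k * w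
    rw [← hw, mul_comm])

/-- **Separatedness on `BdRPlusTop`**: if `x ∈ p^N·ofAinf(𝔸_inf) + Fil^k` for all `N` then `x ∈ Fil^k`.
[cite: FontaineAsterisque223III, Exp. II §1.5.3] -/
theorem mem_filOne_pow_of_forall_lattice {x : BdRPlusTop F p} {k : ℕ}
    (h : ∀ N : ℕ, ∃ (a : Ainf (p := p) F) (w : BdRPlusTop F p), x = ofAinf F p ((p : Ainf (p := p) F) ^ N * a) + of F p xiBdR ^ k * w) :
    x ∈ ((filOne F p).toIdeal ^ k : Ideal (BdRPlusTop F p)) := by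
  rw [show (filOne F p).toIdeal = (WithIdeal.i : Ideal (BdRPlusTop F p)) from rfl, ideal_eq, Ideal.span_singleton_pow]
  have hx : (of F p).symm x ∈ Ideal.span {(xiBdR : BDeRhamPlus (integerC F) p) ^ k} :=
    GaloisContinuity.mem_span_xiBdR_pow_of_forall_lattice fun N => by
      obtain ⟨a, w, hN⟩ := h N
      exact ⟨a, (of F p).symm w, by rw [hN]; rfl⟩
  obtain ⟨c, hc⟩ := Ideal.mem_span_singleton'.1 hx
  refine Ideal.mem_span_singleton'.2 ⟨of F p c, ?_⟩
  apply (of F p).symm.injective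
  rw [← hc]
  rfl

/-- **Hausdorff**: an element of `BdRPlusTop` in every lattice `p^N·ofAinf(𝔸_inf) + Fil^k` is `0`. [cite: FontaineAsterisque223III, Exp. II §1.5.5] -/
theorem eq_zero_of_forall_lattice {x : BdRPlusTop F p}
    (h : ∀ k N : ℕ, ∃ (a : Ainf (p := p) F) (w : BdRPlusTop F p), x = ofAinf F p ((p : Ainf (p := p) F) ^ N * a) + of F p xiBdR ^ k * w) :
    x = 0 := by
  have hx : (of F p).symm x = 0 :=
    GaloisContinuity.eq_zero_of_forall_lattice fun k N => by
      obtain ⟨a, w, hN⟩ := h k N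
      exact ⟨a, (of F p).symm w, by rw [hN]; rfl⟩
  simpa using hx

end BdRPlusTop

end Literature.NumberTheory.PAdicHodge

end
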